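import Literature.AlgebraicGeometry.Motives.HodgeThetaAnnihilatorTimesRankOneTorus
import HarnessLib

/-!
# Rational tensors on `V₁ ⊕ V₂` killed by `Θ` are killed by `Θ₁ ⊕ 0` when the skew centre of `End_Hdg(V₁)` is a line `ℚφ₁` and `Lie Hg(V₂) ⊆ 𝔲` is a commutative plane of skew operators with NO LINE through an operator of rational square and NO PROPER ANNIHILATING LINE (Moonen–Zarhin 1999 Lemma (3.6): `Hg(X₁ × X₂) = Hg(X₁) × Hg(X₂)` when `Hg(X₂)` is a `ℚ`-simple torus not isogenous to a central torus of `Hg(X₁)` — the Lie step for `X₂` a simple CM surface and `X₁` with centre of rank one, row (5.10))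

Family `hodge`, layer `Literature/AlgebraicGeometry/Motives` (abstract polarizable `ℚ`-Hodge structures; no
geometry). Research context: cell `pub-hodge-ring2` (HONEST FRAMING: research route conditional on HC_CM; not a
corollary; Q11.4-sentence-2 already refuted in dim ≥ 3), Literature lane, programme R28b «`S × T`, `S` a SIMPLE
abelian surface of CM type (`Hg(S) = U_F`, `F = End⁰(S)` a quartic CM field WITHOUT imaginary quadratic subfield),
`T` a simple abelian threefold of type IV NOT of CM type» = Moonen–Zarhin 1999 (5.10), abstract half.
UNCONDITIONAL linear algebra / Hodge theory; theorems only (no definition, no named fact, D-0026; nothing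
admitted); no step towards a summit statement. It is the sibling of `HodgeThetaAnnihilatorTimesRankOneTorus`
(programme R24: second factor the RANK-ONE torus of a CM elliptic curve, where a trace non-resonance is needed)
and of `HodgeThetaAnnihilatorCentreTimesRankOneTorus` (R28a).

PRINTED RESULTS, Lie-algebra form. B. Moonen, Yu. Zarhin, *Hodge classes on abelian varieties of low dimension*,
Math. Ann. 315 (1999) 711–733 [held: `paper:arxiv-math_9901113`]:
* §3 Lemma (3.6) (p. 7): «Let `X₁` and `X₂` be nonzero complex abelian varieties. Assume that the Hodge group
  `Hg(X₂)` is a `ℚ`-simple algebraic torus. (In particular `X₂` is of CM-type.) Write `X = X₁ × X₂`. If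
  `Hg(X) ≠ Hg(X₁) × Hg(X₂)` then the center of `Hg(X₁)` contains an algebraic torus which is `ℚ`-isogenous to
  `Hg(X₂)`.» Proof (ibid.): «The assumption that `Hg(X₂)` is `ℚ`-simple implies that `hg(X₂)` does not contain a
  proper algebraic Lie subalgebra. Using the notations of (3.1) we then have that `hg(X) = 𝔤₁ ⊕ 𝔤₃ ≅ hg(X₁)` and
  `hg(X₂) ≅ 𝔤₃`.»
* §5 (5.10) (p. 10): «`X ∼ Y₁ × Y₂` where `Y₁` is a simple abelian surface and `Y₂` is a simple abelian threefold.
  Note that `Y₁` is of CM-type with `Hg(Y₁) = U_{F₁}`, where `F₁ = End⁰(Y₁)`. If `Y₂` is not of CM-type then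
  Lemma (3.6) readily gives `Hg(X) = Hg(Y₁) × Hg(Y₂)`» … «(as `F₁` does not contain an imaginary quadratic field)».
P. Deligne, LNM 900 (1982), I Prop. 3.6 (`Hg` reductive) — the tree's `ThetaSubalgebra.center_sup_derived_eq`.

THIS FILE (the Lie step of Lemma (3.6) for a RANK-TWO torus against a centre of rank ONE, in the tree's word
model). SETTING: a `ℚ`-space `U = ι₁V₁ ⊕ ι₂V₂`, effective weight-one Hodge structures `H_U, H₁, H₂` (`ι_i` map
pieces into pieces), polarizations `ψ₁, ψ₂`; on `V₁` a Hodge endomorphism `φ₁` such that EVERY `ψ₁`-SKEW CENTRAL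
HODGE ENDOMORPHISM OF `V₁` IS A RATIONAL MULTIPLE OF `φ₁` (`T` simple of type IV with `End⁰(T)` an imaginary
quadratic field, or `φ₁ = 0`); on `V₂` a family `(f_i)` of Hodge endomorphisms and a COMMUTATIVE `ℚ`-subspace `𝔲`
of `ψ₂`-skew operators commuting with the `f_i` (for a simple CM surface: `f_e = e^*`, `e ∈ F = End⁰(S)` a quartic
CM field, and `𝔲 = F⁻ = Lie U_F`) such that
  (COMM) every `ψ₂,ℂ`-skew complex operator commuting with the `f_{i,ℂ}` lies in `𝔲_ℂ` («`hg(S) ⊆ 𝔲_F`»; for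
         `F` quartic acting on the `4`-dimensional `H¹(S)` the skew commutant of `F_ℂ` is `F⁻_ℂ`),
  (NOSQ) no non-zero `y ∈ 𝔲` has `y² ∈ ℚ·1` («`F` does not contain an imaginary quadratic field»: `ℚ(y)` would be
         one), and
  (QS)   if `ι₂y₁π₂` kills the tensor `q` for ONE non-zero `y₁ ∈ 𝔲` then `ι₂yπ₂` kills `q` for EVERY `y ∈ 𝔲`
         («`hg(X₂)` does not contain a proper algebraic Lie subalgebra» — `U_F` is `ℚ`-simple — read on the
         tensor `q`; supplied for `H¹(S)` by the Galois argument of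
         `NumberTheory/ComplexMultiplication/QuarticCMUnitaryTorusQSimple`).
MAIN RESULT (`wordDerAt_incl_theta_proj_eq_zero_of_rankOneCentre_times_qSimpleTorus`): every rational coefficient
tensor `q` on `U` killed slice by slice by the matrix of `Θ_U` is killed by the matrix of the partial Hodge
operator `ι₁ ∘ Θ₁ ∘ π₁` («`Hg(T × S) = Hg(T) × Hg(S)`» read on tensor invariants) — the conclusion of the tree's
`wordDerAt_incl_theta_proj_eq_zero_of_thetaTrace_times_abelian`, so the typed-Künneth pipeline of programme R5
applies verbatim. NO trace non-resonance is needed (contrast R24): a rank-two `ℚ`-simple torus cannot be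
isogenous to a central torus of rank `≤ 1`.

PROOF (R24 verbatim up to the corner algebra, then NEW). `𝔞 = annLie(q)` (killing `q`; commuting with `ι₁aπ₁`
(`a ∈ End_Hdg V₁`), `ι₂f_iπ₂` and the two projectors; skew for `ψ₁(π₁·,π₁·) + ψ₂(π₂·,π₂·)`), so
`Θ_U ∈ 𝔞_ℂ`. The `V₂`-corners of `𝔞` are `ψ₂`-skew and commute with the `f_i`, hence (COMM + descent) lie in
`𝔲` and COMMUTE; Goursat: `ι₁𝔡(𝔤)_ℂπ₁ ⊆ 𝔞_ℂ` for the corner algebra `𝔤 = c₁(𝔞) ∋_ℂ Θ₁`; Deligne reductivity and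
the rank-one centre give `Θ₁ = wφ₁,ℂ + s`, `s ∈ 𝔡(𝔤)_ℂ`. If `w = 0` we are done. Otherwise `φ₁ ∈ 𝔤`: some `X ∈ 𝔞`
has corners `(φ₁, y₀)`, `y₀ ∈ 𝔲`, and `Θ_U - ι₁sπ₁ - w·X_ℂ = ι₂(Θ₂ - w·y₀,ℂ)π₂ ∈ 𝔞_ℂ` with `Θ₂ ∈ 𝔲_ℂ` (COMM).
Let `K = {y ∈ 𝔲 : ι₂yπ₂ ∈ 𝔞}`. By (QS), `K = 𝔲` or `K = 0` (`ι₂yπ₂` commutes with the family and is skew for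
every `y ∈ 𝔲`, so membership in `𝔞` is just «kills `q`»). If `K = 𝔲` then `ι₂Θ₂π₂ ∈ 𝔞_ℂ` and
`ι₁Θ₁π₁ = Θ_U - ι₂Θ₂π₂ ∈ 𝔞_ℂ`. If `K = 0` then `𝔞 ∩ ι₂𝔲π₂ = 0`, hence (BASE CHANGE COMMUTES WITH INTERSECTIONS,
`spanC_inf`, by `dim_ℂ 𝔞_ℂ = dim_ℚ 𝔞` and Grassmann's formula) `𝔞_ℂ ∩ (ι₂𝔲π₂)_ℂ = 0`, so `Θ₂ = w·y₀,ℂ`; then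
`y₀ = 0` gives `Θ₂ = 0` (done trivially), and `y₀ ≠ 0` gives `y₀,ℂ² = w⁻²·Θ₂² = w⁻²` and by descent `y₀² ∈ ℚ·1`,
contradicting (NOSQ). (Moonen–Zarhin: a non-split `Hg(X₁ × X₂)` makes `Hg(X₂) = U_F` (dim `2`, `ℚ`-simple)
isogenous to a torus in the centre of `Hg(X₁)`, of rank `≤ 1` — impossible; `K` is the Lie shadow of the image of
`hg(X)` in `hg(X₂)`, and `w, y₀` of the graph `Γ_φ` of (3.1).)

CONTENTS. §1 base change commutes with intersections (`spanC_inf`) and block placement of spans; §2 the product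
Lie step (`wordDerAt_incl_theta_proj_eq_zero_of_rankOneCentre_times_qSimpleTorus`).

## References

* [MoonenZarhin1999LowDim] B. Moonen, Yu. Zarhin, Math. Ann. 315 (1999), §3 (3.1), Lemma (3.6), §5 (5.10)
  (held `paper:arxiv-math_9901113` pp. 6–7, 10). [cite: MoonenZarhin1999LowDim, §3 Lemma (3.6)]
* [Deligne1982HodgeCycles] P. Deligne, LNM 900 (1982), I §3 Prop. 3.4 (rational structures and base change),
  Prop. 3.6 (reductivity). [cite: Deligne1982HodgeCycles, I §3 Prop. 3.6]
* [Lombardo2016] D. Lombardo, Ann. Inst. Fourier 66 (2016), Lemma 3.4 (p. 1229) (the Goursat step). [cite: Lombardo2016, Lemma 3.4 (p. 1229)]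
-/

noncomputable section

open scoped TensorProduct
open CategoryTheory Module

namespace Literature.AlgebraicGeometry.Motives

namespace HodgeStructure

open Literature.RepresentationTheory.GeneralLinear

universe u

/-! ### §1 Base change commutes with intersections; block placement of complex spans -/

section SpanC

variable {U V : Type u} [AddCommGroup U] [Module ℚ U] [AddCommGroup V] [Module ℚ V]

/-- **Base change commutes with intersections**: `(𝔞 ∩ 𝔟)_ℂ = 𝔞_ℂ ∩ 𝔟_ℂ` for rational spaces of operators
(`dim_ℂ 𝔞_ℂ = dim_ℚ 𝔞`, `finrank_spanC_eq`, and Grassmann's formula `dim(𝔞 + 𝔟) + dim(𝔞 ∩ 𝔟) = dim 𝔞 + dim 𝔟`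
on both sides, with `(𝔞 + 𝔟)_ℂ = 𝔞_ℂ + 𝔟_ℂ`). Deligne I §3: `ℂ ⊗ -` is exact on rational structures.
[cite: Deligne1982HodgeCycles, I §3 (proof of Prop. 3.4)] -/
theorem spanC_inf [Module.Finite ℚ V] (𝔞 𝔟 : Submodule ℚ (Module.End ℚ V)) :
    spanC (𝔞 ⊓ 𝔟) = spanC 𝔞 ⊓ spanC 𝔟 := by
  apply Submodule.eq_of_le_of_finrank_eq (le_inf (spanC_mono inf_le_left) (spanC_mono inf_le_right))
  have h1 := Submodule.finrank_sup_add_finrank_inf_eq (spanC 𝔞) (spanC 𝔟)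
  have h2 := Submodule.finrank_sup_add_finrank_inf_eq 𝔞 𝔟
  rw [← spanC_sup, finrank_spanC_eq, finrank_spanC_eq, finrank_spanC_eq] at h1
  rw [finrank_spanC_eq]
  omega

/-- **Block placement of a complex span**: if `ι y π ∈ 𝔟` for every `y ∈ 𝔲`, then `ι_ℂ T π_ℂ ∈ 𝔟_ℂ` for every
`T ∈ 𝔲_ℂ`. [cite: Deligne1982HodgeCycles, I §3 (proof of Prop. 3.4)] -/
theorem incl_comp_proj_mem_spanC_of_forall_mem {𝔲 : Submodule ℚ (Module.End ℚ V)}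
    {𝔟 : Submodule ℚ (Module.End ℚ U)} {ι : V →ₗ[ℚ] U} {π : U →ₗ[ℚ] V} (h : ∀ y ∈ 𝔲, ι ∘ₗ y ∘ₗ π ∈ 𝔟)
    {T : Module.End ℂ (ℂ ⊗[ℚ] V)} (hT : T ∈ spanC 𝔲) :
    ι.baseChange ℂ ∘ₗ T ∘ₗ π.baseChange ℂ ∈ spanC 𝔟 := by
  induction hT using Submodule.span_induction with
  | mem Z hZ =>
    obtain ⟨y, hy, rfl⟩ := hZ
    rw [← LinearMap.baseChange_comp, ← LinearMap.baseChange_comp]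
    exact baseChange_mem_spanC (h y hy)
  | zero => rw [LinearMap.zero_comp, LinearMap.comp_zero]; exact Submodule.zero_mem _
  | add Z Z' _ _ hZ hZ' => rw [LinearMap.add_comp, LinearMap.comp_add]; exact Submodule.add_mem _ hZ hZ'
  | smul c Z _ hZ => rw [LinearMap.smul_comp, LinearMap.comp_smul]; exact Submodule.smul_mem _ c hZ

omit [AddCommGroup U] [Module ℚ U] in
/-- Complexification of a sum of bilinear forms, evaluated (a copy of the private lemma of
`HodgeThetaAnnihilatorTimesNonCMCurve`). [folklore] -/
private theorem baseChange_add_apply₃ (B B' : LinearMap.BilinForm ℚ V) (x y : ℂ ⊗[ℚ] V) :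
    LinearMap.BilinForm.baseChange ℂ (B + B') x y =
      LinearMap.BilinForm.baseChange ℂ B x y + LinearMap.BilinForm.baseChange ℂ B' x y := by
  induction x using TensorProduct.induction_on with
  | zero => simp
  | tmul c v =>
    induction y using TensorProduct.induction_on with
    | zero => simp
    | tmul d w =>
      simp only [LinearMap.BilinForm.baseChange_tmul, LinearMap.add_apply, add_smul]
    | add y y' hy hy' => rw [map_add, map_add, map_add, hy, hy']; abel
  | add x x' hx hx' =>
    rw [map_add, LinearMap.add_apply, map_add, map_add, LinearMap.add_apply, LinearMap.add_apply, hx, hx']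
    abel

omit [AddCommGroup U] [Module ℚ U] in
/-- `(1 : End_ℚ V)_ℂ = 1`. [folklore] -/
private theorem baseChange_one_eq : (1 : Module.End ℚ V).baseChange ℂ = 1 := by
  refine TensorProduct.AlgebraTensorModule.ext fun z v => ?_
  rw [LinearMap.baseChange_tmul, Module.End.one_apply, Module.End.one_apply]

end SpanC

/-! ### §2 The product Lie step: rank-one centre times a `ℚ`-simple rank-two torus -/

section Main

variable {U V₁ V₂ : Type u} [AddCommGroup U] [Module ℚ U] [AddCommGroup V₁] [Module ℚ V₁]
  [AddCommGroup V₂] [Module ℚ V₂] [Module.Finite ℚ U] [Module.Finite ℚ V₁] [Module.Finite ℚ V₂]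
  [HodgeTensorFacts.{u, u}] {n : ℤ}
variable {M d m : ℕ}

/-- **Theorem (Moonen–Zarhin 1999 Lemma (3.6) for a `ℚ`-simple rank-two torus against a centre of rank one, Lie
step, word model).** Let `U = ι₁V₁ ⊕ ι₂V₂` be a presentation compatible with effective weight-one Hodge structures
`H_U, H₁, H₂`, polarizations `ψ₁, ψ₂`; `φ₁ ∈ End(V₁)` such that every `ψ₁`-skew central Hodge endomorphism of
`V₁` is a rational multiple of `φ₁` («the centre of `Hg(X₁)` has rank `≤ 1`»: `X₁ = T` simple of type IV with
`End⁰(T)` imaginary quadratic, or `φ₁ = 0`); on `V₂` a family `(f_i)` of Hodge endomorphisms and a commutative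
`ℚ`-subspace `𝔲` of `ψ₂`-skew operators commuting with the `f_i` such that (COMM) every `ψ₂,ℂ`-skew complex
operator commuting with the `f_{i,ℂ}` lies in `𝔲_ℂ` (`f_e = e^*`, `e ∈ F = End⁰(S)` quartic CM, `𝔲 = F⁻ = Lie U_F`),
(NOSQ) no non-zero `y ∈ 𝔲` has `y² ∈ ℚ·1`, and (QS) for the rational tensor `q` at hand: if `ι₂y₁π₂` kills
`q` for one non-zero `y₁ ∈ 𝔲` then `ι₂yπ₂` kills `q` for every `y ∈ 𝔲` («`Hg(X₂) = U_F` is a `ℚ`-simple algebraic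
torus … `hg(X₂)` does not contain a proper algebraic Lie subalgebra», `F` without imaginary quadratic subfield).
Then if `q` is killed slice by slice by the matrix of `Θ_U`, it is killed by the matrix of the partial Hodge
operator `ι₁ ∘ Θ₁ ∘ π₁` — «`Hg(X₁ × X₂) = Hg(X₁) × Hg(X₂)`» read on tensor invariants («If `Hg(X) ≠ Hg(X₁) × Hg(X₂)`
then the center of `Hg(X₁)` contains an algebraic torus which is `ℚ`-isogenous to `Hg(X₂)`» — of dimension `2`,
impossible in a centre of rank `≤ 1`; «If `Y₂` is not of CM-type then Lemma (3.6) readily gives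
`Hg(X) = Hg(Y₁) × Hg(Y₂)`»). [cite: MoonenZarhin1999LowDim, §3 Lemma (3.6) and §5 (5.10)]
[cite: MoonenZarhin1999LowDim, §3 (3.1)] [cite: Deligne1982HodgeCycles, I §3 Prop. 3.4 and Prop. 3.6]
[cite: Lombardo2016, Lemma 3.4 (p. 1229)] -/
theorem wordDerAt_incl_theta_proj_eq_zero_of_rankOneCentre_times_qSimpleTorus (hn : n = 1)
    (HU : HodgeStructure U n) (H₁ : HodgeStructure V₁ n) (H₂ : HodgeStructure V₂ n) (heff₁ : H₁.IsEffective)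
    (heff₂ : H₂.IsEffective)
    {ι₁ : V₁ →ₗ[ℚ] U} {π₁ : U →ₗ[ℚ] V₁} {ι₂ : V₂ →ₗ[ℚ] U} {π₂ : U →ₗ[ℚ] V₂}
    (hπι₁ : π₁ ∘ₗ ι₁ = LinearMap.id) (hπι₂ : π₂ ∘ₗ ι₂ = LinearMap.id) (hπ₁ι₂ : π₁ ∘ₗ ι₂ = 0)
    (hπ₂ι₁ : π₂ ∘ₗ ι₁ = 0) (hsum : ι₁ ∘ₗ π₁ + ι₂ ∘ₗ π₂ = LinearMap.id)
    (hι₁F : ∀ p, ∀ x ∈ H₁.piece p (n - p), ι₁.baseChange ℂ x ∈ HU.piece p (n - p))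
    (hι₂F : ∀ p, ∀ x ∈ H₂.piece p (n - p), ι₂.baseChange ℂ x ∈ HU.piece p (n - p))
    (ψ₁ : H₁.Polarization) (ψ₂ : H₂.Polarization) {φ₁ : Module.End ℚ V₁}
    (hZ₁ : ∀ a ∈ H₁.endAlg, (∀ b ∈ H₁.endAlg, a * b = b * a) →
      (∀ v w, ψ₁.form (a v) w + ψ₁.form v (a w) = 0) → ∃ x : ℚ, a = x • φ₁)
    {ιF : Type*} (fam : ιF → Module.End ℚ V₂) (hfamE : ∀ i, fam i ∈ H₂.endAlg)
    (𝔲 : Submodule ℚ (Module.End ℚ V₂)) (h𝔲fam : ∀ y ∈ 𝔲, ∀ i, y * fam i = fam i * y)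
    (h𝔲c : ∀ y ∈ 𝔲, ∀ y' ∈ 𝔲, y * y' = y' * y)
    (h𝔲skew : ∀ y ∈ 𝔲, ∀ v w, ψ₂.form (y v) w + ψ₂.form v (y w) = 0)
    (hcommC : ∀ Y : Module.End ℂ (ℂ ⊗[ℚ] V₂), (∀ i, Y * (fam i).baseChange ℂ = (fam i).baseChange ℂ * Y) →
      (∀ x y, ψ₂.form.baseChange ℂ (Y x) y + ψ₂.form.baseChange ℂ x (Y y) = 0) → Y ∈ spanC 𝔲)
    (hnosq : ∀ y ∈ 𝔲, y ≠ 0 → ∀ r : ℚ, y * y ≠ r • 1)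
    (eQ : Module.Basis (Fin M) ℚ U) (q : (Fin d → Fin m × Fin M) → ℚ)
    (hQS : ∀ y₁ ∈ 𝔲, y₁ ≠ 0 →
      (∀ u : Fin d → Fin m, wordDerAt ℚ (fun _ : Fin d => LinearMap.toMatrix eQ eQ (ι₂ ∘ₗ y₁ ∘ₗ π₂))
        (wordSlice q u) = 0) →
      ∀ y ∈ 𝔲, ∀ u : Fin d → Fin m, wordDerAt ℚ (fun _ : Fin d => LinearMap.toMatrix eQ eQ (ι₂ ∘ₗ y ∘ₗ π₂))
        (wordSlice q u) = 0)
    {ΘU : Module.End ℂ (ℂ ⊗[ℚ] U)} (hΘU : ∀ p, ∀ x ∈ HU.piece p (n - p), ΘU x = ((2 * p - n : ℤ) : ℂ) • x)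
    {Θ₁ : Module.End ℂ (ℂ ⊗[ℚ] V₁)} (hΘ₁ : ∀ p, ∀ x ∈ H₁.piece p (n - p), Θ₁ x = ((2 * p - n : ℤ) : ℂ) • x)
    {Θ₂ : Module.End ℂ (ℂ ⊗[ℚ] V₂)} (hΘ₂ : ∀ p, ∀ x ∈ H₂.piece p (n - p), Θ₂ x = ((2 * p - n : ℤ) : ℂ) • x)
    (hΘq : ∀ u : Fin d → Fin m, wordDerAt ℂ (fun _ : Fin d =>
      LinearMap.toMatrix (Algebra.TensorProduct.basis ℂ eQ) (Algebra.TensorProduct.basis ℂ eQ) ΘU)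
      (wordSlice (fun w => algebraMap ℚ ℂ (q w)) u) = 0)
    (u : Fin d → Fin m) :
    wordDerAt ℂ (fun _ : Fin d =>
      LinearMap.toMatrix (Algebra.TensorProduct.basis ℂ eQ) (Algebra.TensorProduct.basis ℂ eQ)
        (ι₁.baseChange ℂ ∘ₗ Θ₁ ∘ₗ π₁.baseChange ℂ))
      (wordSlice (fun w => algebraMap ℚ ℂ (q w)) u) = 0 := by
  classical
  have hΘ₁C : Θ₁ ∈ H₁.hodgeLieC := H₁.mem_hodgeLieC_of_forall_piece hΘ₁
  have hΘ₂C : Θ₂ ∈ H₂.hodgeLieC := H₂.mem_hodgeLieC_of_forall_piece hΘ₂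
  have hsum' : ι₂ ∘ₗ π₂ + ι₁ ∘ₗ π₁ = LinearMap.id := by rw [add_comm]; exact hsum
  -- pointwise slot identities
  have e11 : ∀ v, π₁ (ι₁ v) = v := fun v => by
    rw [← LinearMap.comp_apply (f := π₁), hπι₁, LinearMap.id_apply]
  have e22 : ∀ w, π₂ (ι₂ w) = w := fun w => by
    rw [← LinearMap.comp_apply (f := π₂), hπι₂, LinearMap.id_apply]
  have e12 : ∀ w, π₁ (ι₂ w) = 0 := fun w => by
    rw [← LinearMap.comp_apply (f := π₁), hπ₁ι₂, LinearMap.zero_apply]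
  have e21 : ∀ v, π₂ (ι₁ v) = 0 := fun v => by
    rw [← LinearMap.comp_apply (f := π₂), hπ₂ι₁, LinearMap.zero_apply]
  -- `Θ` through the presentation
  have hΘι₁ := theta_incl_eq HU H₁ hι₁F hΘU hΘ₁
  have hΘι₂ := theta_incl_eq HU H₂ hι₂F hΘU hΘ₂
  have hΘπ₁ := proj_theta_eq HU H₁ H₂ hπι₁ hπ₁ι₂ hsum hι₁F hι₂F hΘU hΘ₁ hΘ₂
  have hΘπ₂ := proj_theta_eq HU H₂ H₁ hπι₂ hπ₂ι₁ hsum' hι₂F hι₁F hΘU hΘ₂ hΘ₁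
  have hΘUdec : ΘU = ι₁.baseChange ℂ ∘ₗ Θ₁ ∘ₗ π₁.baseChange ℂ + ι₂.baseChange ℂ ∘ₗ Θ₂ ∘ₗ π₂.baseChange ℂ := by
    apply LinearMap.ext
    intro y
    conv_lhs => rw [← incl_proj_add_baseChange hsum y]
    rw [map_add, hΘι₁, hΘι₂]
    rfl
  -- the commuting family: `ι₁ a π₁` (`a ∈ End_Hdg V₁`), `ι₂ f_i π₂` (the `V₂`-family), the two projectors
  set aF : (H₁.endAlg ⊕ ιF) ⊕ (Unit ⊕ Unit) → Module.End ℚ U :=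
    Sum.elim (Sum.elim (fun a => ι₁ ∘ₗ (a : Module.End ℚ V₁) ∘ₗ π₁) (fun i => ι₂ ∘ₗ fam i ∘ₗ π₂))
      (Sum.elim (fun _ => ι₁ ∘ₗ π₁) (fun _ => ι₂ ∘ₗ π₂)) with haF
  set φ : LinearMap.BilinForm ℚ U := ψ₁.form.compl₁₂ π₁ π₁ + ψ₂.form.compl₁₂ π₂ π₂ with hφ
  have hφC : ∀ x y, φ.baseChange ℂ x y = ψ₁.form.baseChange ℂ (π₁.baseChange ℂ x) (π₁.baseChange ℂ y) +
      ψ₂.form.baseChange ℂ (π₂.baseChange ℂ x) (π₂.baseChange ℂ y) := fun x y => by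
    rw [hφ, baseChange_add_apply₃, baseChange_compl₁₂_apply, baseChange_compl₁₂_apply]
  have hφapply : ∀ x y, φ x y = ψ₁.form (π₁ x) (π₁ y) + ψ₂.form (π₂ x) (π₂ y) := fun x y => by
    rw [hφ, LinearMap.add_apply, LinearMap.add_apply, LinearMap.compl₁₂_apply, LinearMap.compl₁₂_apply]
  set 𝔞 : Submodule ℚ (Module.End ℚ U) := annLie φ eQ aF q with h𝔞
  -- `Θ_U ∈ 𝔞_ℂ`
  have hΘ𝔞 : ΘU ∈ spanC 𝔞 := by
    refine mem_spanC_annLie φ eQ aF q hΘq (fun i => ?_) (fun x y => ?_)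
    · apply LinearMap.ext
      intro y
      rcases i with (a | i) | (_ | _)
      · change ΘU ((ι₁ ∘ₗ (a : Module.End ℚ V₁) ∘ₗ π₁).baseChange ℂ y) =
          (ι₁ ∘ₗ (a : Module.End ℚ V₁) ∘ₗ π₁).baseChange ℂ (ΘU y)
        simp only [LinearMap.baseChange_comp, LinearMap.comp_apply]
        rw [hΘι₁, ← Module.End.mul_apply (f := Θ₁), commute_baseChange_of_mem_hodgeLieC H₁ hΘ₁C a,
          Module.End.mul_apply, hΘπ₁]
      · change ΘU ((ι₂ ∘ₗ fam i ∘ₗ π₂).baseChange ℂ y) = (ι₂ ∘ₗ fam i ∘ₗ π₂).baseChange ℂ (ΘU y)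
        simp only [LinearMap.baseChange_comp, LinearMap.comp_apply]
        rw [hΘι₂, ← Module.End.mul_apply (f := Θ₂), commute_baseChange_of_mem_hodgeLieC H₂ hΘ₂C ⟨fam i, hfamE i⟩,
          Module.End.mul_apply, hΘπ₂]
      · change ΘU ((ι₁ ∘ₗ π₁).baseChange ℂ y) = (ι₁ ∘ₗ π₁).baseChange ℂ (ΘU y)
        simp only [LinearMap.baseChange_comp, LinearMap.comp_apply]
        rw [hΘι₁, hΘπ₁]
      · change ΘU ((ι₂ ∘ₗ π₂).baseChange ℂ y) = (ι₂ ∘ₗ π₂).baseChange ℂ (ΘU y)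
        simp only [LinearMap.baseChange_comp, LinearMap.comp_apply]
        rw [hΘι₂, hΘπ₂]
    · rw [hφC, hφC, hΘπ₁, hΘπ₁, hΘπ₂, hΘπ₂, formBaseChange_skew_of_mem_hodgeLieC ψ₁ hΘ₁C,
        formBaseChange_skew_of_mem_hodgeLieC ψ₂ hΘ₂C]
      ring
  -- what membership in `𝔞` gives
  have hmem : ∀ X ∈ 𝔞, (∀ i, X * aF i = aF i * X) ∧ ∀ v w, φ (X v) w + φ v (X w) = 0 :=
    fun X hX => ((mem_annLie_iff φ eQ aF q X).1 hX).2
  have hP₁ : ∀ X ∈ 𝔞, X * (ι₁ ∘ₗ π₁) = (ι₁ ∘ₗ π₁) * X := fun X hX => (hmem X hX).1 (Sum.inr (Sum.inl ()))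
  have hP₂ : ∀ X ∈ 𝔞, X * (ι₂ ∘ₗ π₂) = (ι₂ ∘ₗ π₂) * X := fun X hX => (hmem X hX).1 (Sum.inr (Sum.inr ()))
  have hTa : ∀ X ∈ 𝔞, ∀ a : H₁.endAlg, X * (ι₁ ∘ₗ (a : Module.End ℚ V₁) ∘ₗ π₁) =
      (ι₁ ∘ₗ (a : Module.End ℚ V₁) ∘ₗ π₁) * X := fun X hX a => (hmem X hX).1 (Sum.inl (Sum.inl a))
  have hTb : ∀ X ∈ 𝔞, ∀ i, X * (ι₂ ∘ₗ fam i ∘ₗ π₂) = (ι₂ ∘ₗ fam i ∘ₗ π₂) * X :=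
    fun X hX i => (hmem X hX).1 (Sum.inl (Sum.inr i))
  -- the corners commute with `End_Hdg(V₁)` resp. the `V₂`-family, and are skew
  have hc₁comm : ∀ X ∈ 𝔞, ∀ a : H₁.endAlg, (π₁ ∘ₗ X ∘ₗ ι₁) * (a : Module.End ℚ V₁) =
      (a : Module.End ℚ V₁) * (π₁ ∘ₗ X ∘ₗ ι₁) := by
    intro X hX a
    apply LinearMap.ext
    intro v
    have h := congrArg (fun f : Module.End ℚ U => π₁ (f (ι₁ v))) (hTa X hX a)
    simp only [Module.End.mul_apply, LinearMap.comp_apply, e11] at h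
    simp only [Module.End.mul_apply, LinearMap.comp_apply]
    exact h
  have hc₂comm : ∀ X ∈ 𝔞, ∀ i, (π₂ ∘ₗ X ∘ₗ ι₂) * fam i = fam i * (π₂ ∘ₗ X ∘ₗ ι₂) := by
    intro X hX i
    apply LinearMap.ext
    intro w
    have h := congrArg (fun g : Module.End ℚ U => π₂ (g (ι₂ w))) (hTb X hX i)
    simp only [Module.End.mul_apply, LinearMap.comp_apply, e22] at h
    simp only [Module.End.mul_apply, LinearMap.comp_apply]
    exact h
  have hc₁skew : ∀ X ∈ 𝔞, ∀ v w, ψ₁.form ((π₁ ∘ₗ X ∘ₗ ι₁) v) w + ψ₁.form v ((π₁ ∘ₗ X ∘ₗ ι₁) w) = 0 := by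
    intro X hX v w
    have h := (hmem X hX).2 (ι₁ v) (ι₁ w)
    rw [apply_incl_eq_of_commute_projector hπι₁ (hP₁ X hX) v,
      apply_incl_eq_of_commute_projector hπι₁ (hP₁ X hX) w, hφapply, hφapply] at h
    simp only [e11, e21, map_zero, add_zero] at h
    simpa only [LinearMap.comp_apply] using h
  have hc₂skew : ∀ X ∈ 𝔞, ∀ v w, ψ₂.form ((π₂ ∘ₗ X ∘ₗ ι₂) v) w + ψ₂.form v ((π₂ ∘ₗ X ∘ₗ ι₂) w) = 0 := by
    intro X hX v w
    have h := (hmem X hX).2 (ι₂ v) (ι₂ w)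
    rw [apply_incl_eq_of_commute_projector hπι₂ (hP₂ X hX) v,
      apply_incl_eq_of_commute_projector hπι₂ (hP₂ X hX) w, hφapply, hφapply] at h
    simp only [e22, e12, map_zero, zero_add] at h
    simpa only [LinearMap.comp_apply] using h
  -- the `V₂`-corners lie in the plane `𝔲` (COMM + descent), hence commute
  have hc₂𝔲 : ∀ X ∈ 𝔞, π₂ ∘ₗ X ∘ₗ ι₂ ∈ 𝔲 := by
    intro X hX
    refine mem_of_baseChange_mem_spanC 𝔲 (hcommC _ (fun i => ?_)
      (ThetaSubalgebra.formBaseChange_add_eq_zero_of_skew ψ₂ (hc₂skew X hX)))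
    rw [← LinearMap.baseChange_mul, hc₂comm X hX i, LinearMap.baseChange_mul]
  have hc₂c : ∀ X ∈ 𝔞, ∀ X' ∈ 𝔞,
      (π₂ ∘ₗ X ∘ₗ ι₂) * (π₂ ∘ₗ X' ∘ₗ ι₂) = (π₂ ∘ₗ X' ∘ₗ ι₂) * (π₂ ∘ₗ X ∘ₗ ι₂) := fun X hX X' hX' =>
    h𝔲c _ (hc₂𝔲 X hX) _ (hc₂𝔲 X' hX')
  -- the Goursat step inside `𝔞`
  have hbr𝔞 : ∀ X ∈ 𝔞, ∀ X' ∈ 𝔞,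
      ι₁ ∘ₗ ((π₁ ∘ₗ X ∘ₗ ι₁) * (π₁ ∘ₗ X' ∘ₗ ι₁) - (π₁ ∘ₗ X' ∘ₗ ι₁) * (π₁ ∘ₗ X ∘ₗ ι₁)) ∘ₗ π₁ ∈ 𝔞 := by
    intro X hX X' hX'
    rw [← bracket_eq_incl_corner_bracket_proj hπι₁ hπι₂ hsum (hP₁ X hX) (hP₂ X hX) (hP₁ X' hX') (hP₂ X' hX')
      (hc₂c X hX X' hX')]
    exact commutator_mem_annLie φ eQ aF q hX hX'
  -- the corner algebra `𝔤 = c₁(𝔞)`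
  obtain ⟨cLin, hcLin⟩ : ∃ L : Module.End ℚ U →ₗ[ℚ] Module.End ℚ V₁, ∀ X, L X = π₁ ∘ₗ X ∘ₗ ι₁ :=
    ⟨{ toFun := fun X => π₁ ∘ₗ X ∘ₗ ι₁
       map_add' := fun X X' => by rw [LinearMap.add_comp, LinearMap.comp_add]
       map_smul' := fun c X => by rw [LinearMap.smul_comp, LinearMap.comp_smul, RingHom.id_apply] },
      fun X => rfl⟩
  set 𝔤 : Submodule ℚ (Module.End ℚ V₁) := 𝔞.map cLin with h𝔤
  have h𝔤mem : ∀ {Y}, Y ∈ 𝔤 ↔ ∃ X ∈ 𝔞, π₁ ∘ₗ X ∘ₗ ι₁ = Y := by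
    intro Y
    rw [h𝔤, Submodule.mem_map]
    simp only [hcLin]
  have hbr𝔤 : ∀ Y ∈ 𝔤, ∀ Y' ∈ 𝔤, Y * Y' - Y' * Y ∈ 𝔤 := by
    intro Y hY Y' hY'
    obtain ⟨X, hX, rfl⟩ := h𝔤mem.1 hY
    obtain ⟨X', hX', rfl⟩ := h𝔤mem.1 hY'
    refine h𝔤mem.2 ⟨_, hbr𝔞 X hX X' hX', ?_⟩
    apply LinearMap.ext
    intro v
    simp only [LinearMap.comp_apply, LinearMap.sub_apply, Module.End.mul_apply, e11]
  have hcomm𝔤 : ∀ Y ∈ 𝔤, ∀ a : H₁.endAlg, Y * (a : Module.End ℚ V₁) = (a : Module.End ℚ V₁) * Y := by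
    intro Y hY a
    obtain ⟨X, hX, rfl⟩ := h𝔤mem.1 hY
    exact hc₁comm X hX a
  have hskew𝔤 : ∀ Y ∈ 𝔤, ∀ v w, ψ₁.form (Y v) w + ψ₁.form v (Y w) = 0 := by
    intro Y hY v w
    obtain ⟨X, hX, rfl⟩ := h𝔤mem.1 hY
    exact hc₁skew X hX v w
  have hspanC𝔤 : spanC 𝔤 = Submodule.span ℂ
      ((fun X : Module.End ℚ U => (π₁ ∘ₗ X ∘ₗ ι₁).baseChange ℂ) '' (𝔞 : Set _)) := by
    rw [spanC, h𝔤, Submodule.map_coe, Set.image_image]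
    simp only [hcLin]
  -- `Θ₁ = c₁(Θ_U) ∈ 𝔤_ℂ`
  have hcorner : ∀ T ∈ spanC 𝔞, π₁.baseChange ℂ ∘ₗ T ∘ₗ ι₁.baseChange ℂ ∈ spanC 𝔤 := by
    intro T hT
    induction hT using Submodule.span_induction with
    | mem Z hZ =>
      obtain ⟨X, hX, rfl⟩ := hZ
      rw [← LinearMap.baseChange_comp, ← LinearMap.baseChange_comp]
      exact baseChange_mem_spanC (h𝔤mem.2 ⟨X, hX, rfl⟩)
    | zero => rw [LinearMap.zero_comp, LinearMap.comp_zero]; exact Submodule.zero_mem _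
    | add Z Z' _ _ hZ hZ' => rw [LinearMap.add_comp, LinearMap.comp_add]; exact Submodule.add_mem _ hZ hZ'
    | smul c Z _ hZ => rw [LinearMap.smul_comp, LinearMap.comp_smul]; exact Submodule.smul_mem _ c hZ
  have hΘ₁𝔤 : Θ₁ ∈ spanC 𝔤 := by
    have h : Θ₁ = π₁.baseChange ℂ ∘ₗ ΘU ∘ₗ ι₁.baseChange ℂ := by
      apply LinearMap.ext
      intro x
      rw [LinearMap.comp_apply, LinearMap.comp_apply, hΘι₁, proj_incl_baseChange hπι₁]
    rw [h]
    exact hcorner ΘU hΘ𝔞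
  -- brackets of elements of `𝔤_ℂ`, placed on `V₁`, lie in `𝔞_ℂ`
  have hD : ∀ Y ∈ spanC 𝔤, ∀ Y' ∈ spanC 𝔤,
      ι₁.baseChange ℂ ∘ₗ (Y * Y' - Y' * Y) ∘ₗ π₁.baseChange ℂ ∈ spanC 𝔞 := by
    intro Y hY Y' hY'
    rw [hspanC𝔤] at hY hY'
    exact incl_bracket_proj_mem_spanC 𝔞 hbr𝔞 hY hY'
  -- Deligne reductivity `𝔤 = 𝔷(𝔤) ⊕ 𝔡(𝔤)`, `𝔷(𝔤) ⊆ ℚφ₁`, `Θ₁ = wφ₁,ℂ + s`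
  set 𝔷 : Submodule ℚ (Module.End ℚ V₁) :=
    𝔤 ⊓ Subalgebra.toSubmodule (Subalgebra.centralizer ℚ (𝔤 : Set (Module.End ℚ V₁))) with h𝔷
  set 𝔡 : Submodule ℚ (Module.End ℚ V₁) := Submodule.span ℚ {B | ∃ X ∈ 𝔤, ∃ Y ∈ 𝔤, X * Y - Y * X = B} with h𝔡
  have h𝔷mem : ∀ {Z}, Z ∈ 𝔷 ↔ Z ∈ 𝔤 ∧ ∀ Y ∈ 𝔤, Z * Y = Y * Z := fun {Z} =>
    Literature.Algebra.Lie.TraceSeparating.mem_center_iff 𝔤 Z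
  have hdec : 𝔷 ⊔ 𝔡 = 𝔤 := ThetaSubalgebra.center_sup_derived_eq H₁ hn heff₁ ψ₁ 𝔤 hbr𝔤 hΘ₁ hΘ₁𝔤 hskew𝔤
  have h𝔷le : spanC 𝔷 ≤ ℂ ∙ φ₁.baseChange ℂ := by
    refine Submodule.span_le.2 ?_
    rintro _ ⟨Z, hZ, rfl⟩
    obtain ⟨hZ𝔤, hZc⟩ := h𝔷mem.1 hZ
    obtain ⟨hZE, hZcE⟩ := mem_endAlg_and_commute_of_mem_center H₁ 𝔤 hΘ₁ hΘ₁𝔤 hcomm𝔤 hZ𝔤 hZc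
    obtain ⟨x, rfl⟩ := hZ₁ Z hZE hZcE (hskew𝔤 Z hZ𝔤)
    change (x • φ₁).baseChange ℂ ∈ ℂ ∙ φ₁.baseChange ℂ
    rw [LinearMap.baseChange_smul]
    exact Submodule.smul_of_tower_mem _ x (Submodule.mem_span_singleton_self _)
  have hΘ' : Θ₁ ∈ spanC 𝔷 ⊔ spanC 𝔡 := by rw [← spanC_sup, hdec]; exact hΘ₁𝔤
  obtain ⟨z, hz, s, hs, hzs⟩ := Submodule.mem_sup.1 hΘ'
  obtain ⟨w, hw⟩ := Submodule.mem_span_singleton.1 (h𝔷le hz)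
  -- `ι₁ s π₁ ∈ 𝔞_ℂ` (Goursat)
  have hsmem : ι₁.baseChange ℂ ∘ₗ s ∘ₗ π₁.baseChange ℂ ∈ spanC 𝔞 :=
    incl_comp_proj_mem_spanC_of_mem_span_commutators 𝔞 hD (mem_span_commutators_baseChange_of_mem_spanC_derived hs)
  -- `Θ₂ ∈ 𝔲_ℂ` (COMM)
  have hΘ₂𝔲 : Θ₂ ∈ spanC 𝔲 :=
    hcommC Θ₂ (fun i => commute_baseChange_of_mem_hodgeLieC H₂ hΘ₂C ⟨fam i, hfamE i⟩)
      (fun x y => by rw [formBaseChange_skew_of_mem_hodgeLieC ψ₂ hΘ₂C, neg_add_cancel])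
  -- every `ι₂ y π₂`, `y ∈ 𝔲`, commutes with the family and is skew: membership in `𝔞` is «kills `q`»
  have hJmem : ∀ y ∈ 𝔲, (∀ u : Fin d → Fin m,
      wordDerAt ℚ (fun _ : Fin d => LinearMap.toMatrix eQ eQ (ι₂ ∘ₗ y ∘ₗ π₂)) (wordSlice q u) = 0) →
      ι₂ ∘ₗ y ∘ₗ π₂ ∈ 𝔞 := by
    intro y hy hkill
    refine (mem_annLie_iff φ eQ aF q _).2 ⟨hkill, fun i => ?_, fun v w => ?_⟩
    · apply LinearMap.ext
      intro x
      rcases i with (a | i) | (_ | _)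
      · change (ι₂ ∘ₗ y ∘ₗ π₂) ((ι₁ ∘ₗ (a : Module.End ℚ V₁) ∘ₗ π₁) x) =
          (ι₁ ∘ₗ (a : Module.End ℚ V₁) ∘ₗ π₁) ((ι₂ ∘ₗ y ∘ₗ π₂) x)
        simp only [LinearMap.comp_apply, e21, e12, map_zero]
      · change (ι₂ ∘ₗ y ∘ₗ π₂) ((ι₂ ∘ₗ fam i ∘ₗ π₂) x) = (ι₂ ∘ₗ fam i ∘ₗ π₂) ((ι₂ ∘ₗ y ∘ₗ π₂) x)
        simp only [LinearMap.comp_apply, e22]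
        rw [← Module.End.mul_apply, h𝔲fam y hy i, Module.End.mul_apply]
      · change (ι₂ ∘ₗ y ∘ₗ π₂) ((ι₁ ∘ₗ π₁) x) = (ι₁ ∘ₗ π₁) ((ι₂ ∘ₗ y ∘ₗ π₂) x)
        simp only [LinearMap.comp_apply, e21, e12, map_zero]
      · change (ι₂ ∘ₗ y ∘ₗ π₂) ((ι₂ ∘ₗ π₂) x) = (ι₂ ∘ₗ π₂) ((ι₂ ∘ₗ y ∘ₗ π₂) x)
        simp only [LinearMap.comp_apply, e22]
    · rw [hφapply, hφapply]
      simp only [LinearMap.comp_apply, e12, e22, map_zero, LinearMap.zero_apply, zero_add]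
      exact h𝔲skew y hy (π₂ v) (π₂ w)
  -- goal: `ι₁ Θ₁ π₁ ∈ 𝔞_ℂ`
  suffices hgoal : ι₁.baseChange ℂ ∘ₗ Θ₁ ∘ₗ π₁.baseChange ℂ ∈ spanC 𝔞 from
    wordDerAt_eq_zero_of_mem_spanC_annLie φ eQ aF q hgoal u
  have hΘ₁eq : ι₁.baseChange ℂ ∘ₗ Θ₁ ∘ₗ π₁.baseChange ℂ = ΘU - ι₂.baseChange ℂ ∘ₗ Θ₂ ∘ₗ π₂.baseChange ℂ := by
    rw [hΘUdec, add_sub_cancel_right]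
  by_cases hw0 : w = 0
  · -- the central component vanishes: `Θ₁ = s ∈ 𝔡(𝔤)_ℂ`
    have hΘ₁s : Θ₁ = s := by rw [← hzs, ← hw, hw0, zero_smul, zero_add]
    rw [hΘ₁s]
    exact hsmem
  -- the annihilating subspace `K = {y ∈ 𝔲 : ι₂ y π₂ ∈ 𝔞}` is `𝔲` or `0` (QS)
  by_cases hK : ∀ y ∈ 𝔲, ι₂ ∘ₗ y ∘ₗ π₂ ∈ 𝔞
  · -- `K = 𝔲`: `ι₂ Θ₂ π₂ ∈ 𝔞_ℂ`
    rw [hΘ₁eq]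
    exact Submodule.sub_mem _ hΘ𝔞 (incl_comp_proj_mem_spanC_of_forall_mem hK hΘ₂𝔲)
  · -- `K = 0`
    have hK0 : ∀ y ∈ 𝔲, ι₂ ∘ₗ y ∘ₗ π₂ ∈ 𝔞 → y = 0 := by
      intro y hy hy𝔞
      by_contra hy0
      apply hK
      intro y' hy'
      exact hJmem y' hy' (hQS y hy hy0 ((mem_annLie_iff φ eQ aF q _).1 hy𝔞).1 y' hy')
    -- `φ₁ ∈ 𝔤`: an `X ∈ 𝔞` with corners `(φ₁, y₀)`, `y₀ ∈ 𝔲`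
    have hφ₁z : φ₁.baseChange ℂ ∈ spanC 𝔷 := by
      have h : φ₁.baseChange ℂ = w⁻¹ • z := by rw [← hw, smul_smul, inv_mul_cancel₀ hw0, one_smul]
      rw [h]
      exact Submodule.smul_mem _ _ hz
    have hφ₁𝔤 : φ₁ ∈ 𝔤 := (h𝔷mem.1 (mem_of_baseChange_mem_spanC 𝔷 hφ₁z)).1
    obtain ⟨X, hX, hXc⟩ := h𝔤mem.1 hφ₁𝔤
    set y₀ : Module.End ℚ V₂ := π₂ ∘ₗ X ∘ₗ ι₂ with hy₀
    have hy₀𝔲 : y₀ ∈ 𝔲 := hc₂𝔲 X hX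
    have hXC : X.baseChange ℂ = ι₁.baseChange ℂ ∘ₗ φ₁.baseChange ℂ ∘ₗ π₁.baseChange ℂ +
        ι₂.baseChange ℂ ∘ₗ y₀.baseChange ℂ ∘ₗ π₂.baseChange ℂ := by
      rw [baseChange_eq_incl_corner_add hπι₁ hπι₂ hsum (hP₁ X hX) (hP₂ X hX), hXc]
    have hXmem : X.baseChange ℂ ∈ spanC 𝔞 := baseChange_mem_spanC hX
    -- `Θ_U - ι₁ s π₁ - w X_ℂ = ι₂ (Θ₂ - w y₀,ℂ) π₂ ∈ 𝔞_ℂ ∩ (ι₂ 𝔲 π₂)_ℂ`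
    set R : Module.End ℂ (ℂ ⊗[ℚ] V₂) := Θ₂ - w • y₀.baseChange ℂ with hR
    have hT : ΘU - ι₁.baseChange ℂ ∘ₗ s ∘ₗ π₁.baseChange ℂ - w • X.baseChange ℂ =
        ι₂.baseChange ℂ ∘ₗ R ∘ₗ π₂.baseChange ℂ := by
      rw [hΘUdec, hXC, ← hzs, ← hw, hR]
      simp only [LinearMap.comp_add, LinearMap.add_comp, LinearMap.comp_smul, LinearMap.smul_comp, smul_add,
        LinearMap.comp_sub, LinearMap.sub_comp]
      module
    have hR𝔲 : R ∈ spanC 𝔲 := by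
      rw [hR]
      exact Submodule.sub_mem _ hΘ₂𝔲 (Submodule.smul_mem _ _ (baseChange_mem_spanC hy₀𝔲))
    obtain ⟨J, hJ⟩ : ∃ L : Module.End ℚ V₂ →ₗ[ℚ] Module.End ℚ U, ∀ y, L y = ι₂ ∘ₗ y ∘ₗ π₂ :=
      ⟨{ toFun := fun y => ι₂ ∘ₗ y ∘ₗ π₂
         map_add' := fun y y' => by rw [LinearMap.add_comp, LinearMap.comp_add]
         map_smul' := fun c y => by rw [LinearMap.smul_comp, LinearMap.comp_smul, RingHom.id_apply] },
        fun y => rfl⟩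
    have hTmem𝔞 : ι₂.baseChange ℂ ∘ₗ R ∘ₗ π₂.baseChange ℂ ∈ spanC 𝔞 := by
      rw [← hT]
      exact Submodule.sub_mem _ (Submodule.sub_mem _ hΘ𝔞 hsmem) (Submodule.smul_mem _ _ hXmem)
    have hTmem𝔲 : ι₂.baseChange ℂ ∘ₗ R ∘ₗ π₂.baseChange ℂ ∈ spanC (𝔲.map J) :=
      incl_comp_proj_mem_spanC_of_forall_mem (fun y hy => by
        rw [← hJ]; exact Submodule.mem_map_of_mem hy) hR𝔲
    -- `𝔞 ∩ ι₂ 𝔲 π₂ = 0`, hence (base change commutes with intersections) `ι₂ R π₂ = 0` and `R = 0`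
    have hinf : 𝔞 ⊓ 𝔲.map J = ⊥ := by
      rw [eq_bot_iff]
      rintro Z ⟨hZ𝔞, hZ𝔲⟩
      obtain ⟨y, hy, rfl⟩ := Submodule.mem_map.1 hZ𝔲
      rw [hJ] at hZ𝔞 ⊢
      rw [Submodule.mem_bot, hK0 y hy hZ𝔞, LinearMap.zero_comp, LinearMap.comp_zero]
    have hT0 : ι₂.baseChange ℂ ∘ₗ R ∘ₗ π₂.baseChange ℂ = 0 := by
      have h : ι₂.baseChange ℂ ∘ₗ R ∘ₗ π₂.baseChange ℂ ∈ spanC (𝔞 ⊓ 𝔲.map J) := by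
        rw [spanC_inf]
        exact ⟨hTmem𝔞, hTmem𝔲⟩
      rw [hinf] at h
      have h0 : spanC (⊥ : Submodule ℚ (Module.End ℚ U)) = ⊥ := by
        rw [spanC, Submodule.bot_coe, Set.image_singleton, LinearMap.baseChange_zero,
          Submodule.span_singleton_eq_bot]
      rw [h0, Submodule.mem_bot] at h
      exact h
    have hR0 : R = 0 := by
      apply LinearMap.ext
      intro x
      have h := congrArg (fun f : Module.End ℂ (ℂ ⊗[ℚ] U) => π₂.baseChange ℂ (f (ι₂.baseChange ℂ x))) hT0
      simp only [LinearMap.comp_apply, LinearMap.zero_apply, map_zero, proj_incl_baseChange hπι₂] at h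
      rw [h, LinearMap.zero_apply]
    have hΘ₂eq : Θ₂ = w • y₀.baseChange ℂ := by rw [← sub_eq_zero, ← hR, hR0]
    by_cases hy₀0 : y₀ = 0
    · -- `Θ₂ = 0`
      rw [hΘ₁eq, hΘ₂eq, hy₀0, LinearMap.baseChange_zero, smul_zero, LinearMap.zero_comp, LinearMap.comp_zero,
        sub_zero]
      exact hΘ𝔞
    · -- `y₀ ≠ 0`: `y₀² = w⁻²·1` is rational, contradicting (NOSQ)
      exfalso
      have hΘΘ : ∀ v, Θ₂ (Θ₂ v) = v := (UnitaryTheta.theta_facts H₂ hn heff₂ hΘ₂).2.2.2.2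
      have hsq : (y₀ * y₀).baseChange ℂ = (w * w)⁻¹ • (1 : Module.End ℚ V₂).baseChange ℂ := by
        have hyC : y₀.baseChange ℂ = w⁻¹ • Θ₂ := by
          rw [hΘ₂eq, smul_smul, inv_mul_cancel₀ hw0, one_smul]
        apply LinearMap.ext
        intro v
        rw [LinearMap.baseChange_mul, Module.End.mul_apply, hyC, LinearMap.smul_apply, LinearMap.smul_apply,
          map_smul, hΘΘ, smul_smul, LinearMap.smul_apply, baseChange_one_eq, Module.End.one_apply, mul_inv]
      obtain ⟨c, hc⟩ := exists_eq_ratCast_smul_of_baseChange_eq_smul hsq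
      exact hnosq y₀ hy₀𝔲 hy₀0 c hc

end Main

end HodgeStructure

end Literature.AlgebraicGeometry.Motives

end
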